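import Summits.Parity.GeneralizedHardyLittlewood.Theorems.PrimeLevelFamEdgeMomentsBeyondDiagonalDiagRemThreeThreeMonomials
import HarnessLib

/-!
# Route `PrimeLevelFamEdge`, crux K_A `MomentsBeyondDiagonal` (stmt-Parity-20007), line «petersson_layers» v4, stub `stub_diag`:
# **the profile-weighted sum against the order-`(3,3)` remainder weight** (brick B3b of (R₃₃))

Corollary of `…DiagRemThreeThreeMonomials.abs_monomial_weight_le₃₃` (one monomial `ℓ⁺(k₁)^{m₁}ℓ⁺(k₂)^{m₂}` against `Wt₃₃`) for a
real profile polynomial `P` with `P₀ = 0` (expansion `…profile_expand`, `log Y ≤ L`), exactly as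
`…DiagRemOneThreeMonomials.abs_profile_weight_le₁₃`:

* `abs_profile_weight_le₃₃` — **`|Σ a(k₁)P(ℓ⁺₁/L)·a(k₂)P(ℓ⁺₂/L)·Wt₃₃(k₁,k₂)| ≤ (Σᵢ|Pᵢ|)²·(729Λ⁶Ψ₀ + 140Λ⁴Ψ₂ + 5Λ²Ψ₄ + Ψ₆ + 15Λ²Ψ_B + Ψ_BD)`.**

Def-free; theorems only. Helper `--supports stmt-Parity-20007`; closes nothing; K_A, K_B and the Parity summit are NOT
proved; nothing about Landau–Siegel zeros.

## References
* E. Kowalski, P. Michel, J. VanderKam, J. reine angew. Math. 526 (2000), (22)–(28) pp. 12–15 and Prop. 5.1 p. 18.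
  [cite: KowalskiMichelVanderKam2000, (23)–(28) — derivation (order-(3,3) remainder weight, general profile)]
-/

noncomputable section

open Finset Real Polynomial

namespace Summit.Parity.GeneralizedHardyLittlewood.Theorems.MomentsBeyondDiagonal.DiagCorner

open Summit.Parity.GeneralizedHardyLittlewood.Theorems.BeyondDiagonalBeatsQuarter.Corner

set_option maxHeartbeats 1600000 in
-- large statement
/-- **The profile-weighted sum against the order-`(3,3)` remainder weight** (module docstring).
[cite: KowalskiMichelVanderKam2000, (23)–(28) — derivation (order-(3,3) remainder weight, general profile)] -/
theorem abs_profile_weight_le₃₃ (P : ℝ[X]) (hP0 : P.coeff 0 = 0) {a P2 P4 P6 : ℕ → ℝ}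
    {R₀₀ R₀₁ R₀₂ R₀₃ R₁₀ R₁₁ R₁₂ R₁₃ R₂₀ R₂₁ R₂₂ R₂₃ R₃₀ R₃₁ R₃₂ R₃₃ : ℝ → ℝ}
    {Y α β Λ Ψ₀ Ψ₂ Ψ₄ Ψ₆ ΨB ΨBD L : ℝ}
    (hY : 1 ≤ Y) (hΛ : 1 ≤ Λ) (hβ : |β| ≤ Λ) (hLY : Real.log Y ≤ Λ)
    (hΨ₀ : 0 ≤ Ψ₀) (hΨ₂ : 0 ≤ Ψ₂) (hΨ₄ : 0 ≤ Ψ₄) (hΨ₆ : 0 ≤ Ψ₆) (hΨB : 0 ≤ ΨB) (hΨBD : 0 ≤ ΨBD) (hL : 0 < L)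
    (hYL : Real.log Y ≤ L)
    (h0 : ∀ R : ℝ → ℝ, (R = R₀₀ ∨ R = R₀₁ ∨ R = R₀₂ ∨ R = R₀₃ ∨ R = R₁₀ ∨ R = R₁₁ ∨ R = R₁₂ ∨ R = R₁₃ ∨ R = R₂₀ ∨ R = R₂₁ ∨ R = R₂₂ ∨ R = R₂₃ ∨ R = R₃₀ ∨ R = R₃₁ ∨ R = R₃₂ ∨ R = R₃₃) →
      ∀ i j : ℕ, 1 ≤ i → 1 ≤ j →
      |∑ k₁ ∈ Icc 1 ⌊Y⌋₊, ∑ k₂ ∈ Icc 1 ⌊Y⌋₊,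
          a k₁ * a k₂ * ellp Y k₁ ^ i * ellp Y k₂ ^ j * R (α * k₁ * k₂)| ≤ Real.log Y ^ (i + j) * Ψ₀)
    (h2 : ∀ R : ℝ → ℝ, (R = R₀₀ ∨ R = R₀₁ ∨ R = R₀₃ ∨ R = R₁₀ ∨ R = R₁₁ ∨ R = R₁₂ ∨ R = R₁₃ ∨ R = R₂₁ ∨ R = R₂₂ ∨ R = R₃₀ ∨ R = R₃₁) →
      ∀ i j : ℕ, 1 ≤ i → 1 ≤ j →
      |∑ k₁ ∈ Icc 1 ⌊Y⌋₊, ∑ k₂ ∈ Icc 1 ⌊Y⌋₊,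
          a k₁ * (a k₂ * P2 k₂) * ellp Y k₁ ^ i * ellp Y k₂ ^ j * R (α * k₁ * k₂)| ≤ Real.log Y ^ (i + j) * Ψ₂)
    (h4 : ∀ R : ℝ → ℝ, (R = R₀₀ ∨ R = R₀₁ ∨ R = R₀₂ ∨ R = R₁₀ ∨ R = R₁₁ ∨ R = R₂₀) →
      ∀ i j : ℕ, 1 ≤ i → 1 ≤ j →
      |∑ k₁ ∈ Icc 1 ⌊Y⌋₊, ∑ k₂ ∈ Icc 1 ⌊Y⌋₊,
          a k₁ * (a k₂ * (3 * P2 k₂ ^ 2 - 2 * P4 k₂)) * ellp Y k₁ ^ i * ellp Y k₂ ^ j * R (α * k₁ * k₂)| ≤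
        Real.log Y ^ (i + j) * Ψ₄)
    (h6 : ∀ i j : ℕ, 1 ≤ i → 1 ≤ j →
      |∑ k₁ ∈ Icc 1 ⌊Y⌋₊, ∑ k₂ ∈ Icc 1 ⌊Y⌋₊,
          a k₁ * (a k₂ * (15 * P2 k₂ ^ 3 - 30 * P2 k₂ * P4 k₂ + 16 * P6 k₂)) * ellp Y k₁ ^ i * ellp Y k₂ ^ j *
            R₀₀ (α * k₁ * k₂)| ≤ Real.log Y ^ (i + j) * Ψ₆)
    (hB : ∀ R : ℝ → ℝ, (R = R₀₀ ∨ R = R₀₁ ∨ R = R₁₀ ∨ R = R₀₂ ∨ R = R₂₀ ∨ R = R₁₁) →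
      ∀ i j : ℕ, 1 ≤ i → 1 ≤ j →
      |∑ k₁ ∈ Icc 1 ⌊Y⌋₊, ∑ k₂ ∈ Icc 1 ⌊Y⌋₊,
          (a k₁ * P2 k₁) * (a k₂ * P2 k₂) * ellp Y k₁ ^ i * ellp Y k₂ ^ j * R (α * k₁ * k₂)| ≤
        Real.log Y ^ (i + j) * ΨB)
    (hBD : ∀ i j : ℕ, 1 ≤ i → 1 ≤ j →
      |∑ k₁ ∈ Icc 1 ⌊Y⌋₊, ∑ k₂ ∈ Icc 1 ⌊Y⌋₊,
          (a k₁ * P2 k₁) * (a k₂ * (3 * P2 k₂ ^ 2 - 2 * P4 k₂)) * ellp Y k₁ ^ i * ellp Y k₂ ^ j * R₀₀ (α * k₁ * k₂)| ≤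
        Real.log Y ^ (i + j) * ΨBD) :
    |∑ k₁ ∈ Icc 1 ⌊Y⌋₊, ∑ k₂ ∈ Icc 1 ⌊Y⌋₊,
        a k₁ * P.eval (ellp Y k₁ / L) * (a k₂ * P.eval (ellp Y k₂ / L)) *
          (((2 * β + ellp Y k₁ + ellp Y k₂) ^ 6 - 3 * (2 * β + ellp Y k₁ + ellp Y k₂) ^ 4 * (P2 k₁ + P2 k₂) + 9 * (2 * β + ellp Y k₁ + ellp Y k₂) ^ 2 * (P2 k₁ + P2 k₂) ^ 2 - 6 * (2 * β + ellp Y k₁ + ellp Y k₂) ^ 2 * (P4 k₁ + P4 k₂) - 15 * (P2 k₁ + P2 k₂) ^ 3 + 30 * (P2 k₁ + P2 k₂) * (P4 k₁ + P4 k₂) - 16 * (P6 k₁ + P6 k₂)) / 64 * R₀₀ (α * k₁ * k₂) +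
            (3 * (2 * β + ellp Y k₁ + ellp Y k₂) ^ 5 - 6 * (2 * β + ellp Y k₁ + ellp Y k₂) ^ 3 * (P2 k₁ + P2 k₂) + 9 * (2 * β + ellp Y k₁ + ellp Y k₂) * (P2 k₁ + P2 k₂) ^ 2 - 6 * (2 * β + ellp Y k₁ + ellp Y k₂) * (P4 k₁ + P4 k₂)) / 32 * R₀₁ (α * k₁ * k₂) +
            (3 * (2 * β + ellp Y k₁ + ellp Y k₂) ^ 4 - 9 * (P2 k₁ + P2 k₂) ^ 2 + 6 * (P4 k₁ + P4 k₂)) / 16 * R₀₂ (α * k₁ * k₂) +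
            ((2 * β + ellp Y k₁ + ellp Y k₂) ^ 3 + 3 * (2 * β + ellp Y k₁ + ellp Y k₂) * (P2 k₁ + P2 k₂)) / 8 * R₀₃ (α * k₁ * k₂) +
            (3 * (2 * β + ellp Y k₁ + ellp Y k₂) ^ 5 - 6 * (2 * β + ellp Y k₁ + ellp Y k₂) ^ 3 * (P2 k₁ + P2 k₂) + 9 * (2 * β + ellp Y k₁ + ellp Y k₂) * (P2 k₁ + P2 k₂) ^ 2 - 6 * (2 * β + ellp Y k₁ + ellp Y k₂) * (P4 k₁ + P4 k₂)) / 32 * R₁₀ (α * k₁ * k₂) +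
            (9 * (2 * β + ellp Y k₁ + ellp Y k₂) ^ 4 - 18 * (2 * β + ellp Y k₁ + ellp Y k₂) ^ 2 * (P2 k₁ + P2 k₂) + 27 * (P2 k₁ + P2 k₂) ^ 2 - 18 * (P4 k₁ + P4 k₂)) / 16 * R₁₁ (α * k₁ * k₂) +
            (9 * (2 * β + ellp Y k₁ + ellp Y k₂) ^ 3 - 9 * (2 * β + ellp Y k₁ + ellp Y k₂) * (P2 k₁ + P2 k₂)) / 8 * R₁₂ (α * k₁ * k₂) +
            (3 * (2 * β + ellp Y k₁ + ellp Y k₂) ^ 2 + 3 * (P2 k₁ + P2 k₂)) / 4 * R₁₃ (α * k₁ * k₂) +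
            (3 * (2 * β + ellp Y k₁ + ellp Y k₂) ^ 4 - 9 * (P2 k₁ + P2 k₂) ^ 2 + 6 * (P4 k₁ + P4 k₂)) / 16 * R₂₀ (α * k₁ * k₂) +
            (9 * (2 * β + ellp Y k₁ + ellp Y k₂) ^ 3 - 9 * (2 * β + ellp Y k₁ + ellp Y k₂) * (P2 k₁ + P2 k₂)) / 8 * R₂₁ (α * k₁ * k₂) +
            (9 * (2 * β + ellp Y k₁ + ellp Y k₂) ^ 2 - 9 * (P2 k₁ + P2 k₂)) / 4 * R₂₂ (α * k₁ * k₂) +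
            3 * (2 * β + ellp Y k₁ + ellp Y k₂) / 2 * R₂₃ (α * k₁ * k₂) +
            ((2 * β + ellp Y k₁ + ellp Y k₂) ^ 3 + 3 * (2 * β + ellp Y k₁ + ellp Y k₂) * (P2 k₁ + P2 k₂)) / 8 * R₃₀ (α * k₁ * k₂) +
            (3 * (2 * β + ellp Y k₁ + ellp Y k₂) ^ 2 + 3 * (P2 k₁ + P2 k₂)) / 4 * R₃₁ (α * k₁ * k₂) +
            3 * (2 * β + ellp Y k₁ + ellp Y k₂) / 2 * R₃₂ (α * k₁ * k₂) +
            R₃₃ (α * k₁ * k₂))| ≤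
      (∑ i ∈ Finset.range (P.natDegree + 1), |P.coeff i|) ^ 2 * (729 * Λ ^ 6 * Ψ₀ + 140 * Λ ^ 4 * Ψ₂ + 5 * Λ ^ 2 * Ψ₄ + Ψ₆ + 15 * Λ ^ 2 * ΨB + ΨBD) := by
  have hL0 : 0 ≤ Real.log Y := Real.log_nonneg hY
  set Rg := Finset.range (P.natDegree + 1) with hRg
  set SP : ℝ := ∑ i ∈ Rg, |P.coeff i| with hSP
  have hratio : Real.log Y / L ≤ 1 := (div_le_one hL).2 hYL
  have hratio0 : 0 ≤ Real.log Y / L := div_nonneg hL0 hL.le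
  rw [profile_expand P L Y a a (fun k₁ k₂ ↦
      (((2 * β + ellp Y k₁ + ellp Y k₂) ^ 6 - 3 * (2 * β + ellp Y k₁ + ellp Y k₂) ^ 4 * (P2 k₁ + P2 k₂) + 9 * (2 * β + ellp Y k₁ + ellp Y k₂) ^ 2 * (P2 k₁ + P2 k₂) ^ 2 - 6 * (2 * β + ellp Y k₁ + ellp Y k₂) ^ 2 * (P4 k₁ + P4 k₂) - 15 * (P2 k₁ + P2 k₂) ^ 3 + 30 * (P2 k₁ + P2 k₂) * (P4 k₁ + P4 k₂) - 16 * (P6 k₁ + P6 k₂)) / 64 * R₀₀ (α * k₁ * k₂) +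
            (3 * (2 * β + ellp Y k₁ + ellp Y k₂) ^ 5 - 6 * (2 * β + ellp Y k₁ + ellp Y k₂) ^ 3 * (P2 k₁ + P2 k₂) + 9 * (2 * β + ellp Y k₁ + ellp Y k₂) * (P2 k₁ + P2 k₂) ^ 2 - 6 * (2 * β + ellp Y k₁ + ellp Y k₂) * (P4 k₁ + P4 k₂)) / 32 * R₀₁ (α * k₁ * k₂) +
            (3 * (2 * β + ellp Y k₁ + ellp Y k₂) ^ 4 - 9 * (P2 k₁ + P2 k₂) ^ 2 + 6 * (P4 k₁ + P4 k₂)) / 16 * R₀₂ (α * k₁ * k₂) +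
            ((2 * β + ellp Y k₁ + ellp Y k₂) ^ 3 + 3 * (2 * β + ellp Y k₁ + ellp Y k₂) * (P2 k₁ + P2 k₂)) / 8 * R₀₃ (α * k₁ * k₂) +
            (3 * (2 * β + ellp Y k₁ + ellp Y k₂) ^ 5 - 6 * (2 * β + ellp Y k₁ + ellp Y k₂) ^ 3 * (P2 k₁ + P2 k₂) + 9 * (2 * β + ellp Y k₁ + ellp Y k₂) * (P2 k₁ + P2 k₂) ^ 2 - 6 * (2 * β + ellp Y k₁ + ellp Y k₂) * (P4 k₁ + P4 k₂)) / 32 * R₁₀ (α * k₁ * k₂) +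
            (9 * (2 * β + ellp Y k₁ + ellp Y k₂) ^ 4 - 18 * (2 * β + ellp Y k₁ + ellp Y k₂) ^ 2 * (P2 k₁ + P2 k₂) + 27 * (P2 k₁ + P2 k₂) ^ 2 - 18 * (P4 k₁ + P4 k₂)) / 16 * R₁₁ (α * k₁ * k₂) +
            (9 * (2 * β + ellp Y k₁ + ellp Y k₂) ^ 3 - 9 * (2 * β + ellp Y k₁ + ellp Y k₂) * (P2 k₁ + P2 k₂)) / 8 * R₁₂ (α * k₁ * k₂) +
            (3 * (2 * β + ellp Y k₁ + ellp Y k₂) ^ 2 + 3 * (P2 k₁ + P2 k₂)) / 4 * R₁₃ (α * k₁ * k₂) +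
            (3 * (2 * β + ellp Y k₁ + ellp Y k₂) ^ 4 - 9 * (P2 k₁ + P2 k₂) ^ 2 + 6 * (P4 k₁ + P4 k₂)) / 16 * R₂₀ (α * k₁ * k₂) +
            (9 * (2 * β + ellp Y k₁ + ellp Y k₂) ^ 3 - 9 * (2 * β + ellp Y k₁ + ellp Y k₂) * (P2 k₁ + P2 k₂)) / 8 * R₂₁ (α * k₁ * k₂) +
            (9 * (2 * β + ellp Y k₁ + ellp Y k₂) ^ 2 - 9 * (P2 k₁ + P2 k₂)) / 4 * R₂₂ (α * k₁ * k₂) +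
            3 * (2 * β + ellp Y k₁ + ellp Y k₂) / 2 * R₂₃ (α * k₁ * k₂) +
            ((2 * β + ellp Y k₁ + ellp Y k₂) ^ 3 + 3 * (2 * β + ellp Y k₁ + ellp Y k₂) * (P2 k₁ + P2 k₂)) / 8 * R₃₀ (α * k₁ * k₂) +
            (3 * (2 * β + ellp Y k₁ + ellp Y k₂) ^ 2 + 3 * (P2 k₁ + P2 k₂)) / 4 * R₃₁ (α * k₁ * k₂) +
            3 * (2 * β + ellp Y k₁ + ellp Y k₂) / 2 * R₃₂ (α * k₁ * k₂) +
            R₃₃ (α * k₁ * k₂)))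
    (Icc 1 ⌊Y⌋₊)]
  set G : ℝ := (729 * Λ ^ 6 * Ψ₀ + 140 * Λ ^ 4 * Ψ₂ + 5 * Λ ^ 2 * Ψ₄ + Ψ₆ + 15 * Λ ^ 2 * ΨB + ΨBD) with hG
  have hG0 : 0 ≤ G := by positivity
  have hterm : ∀ i ∈ Rg, ∀ j ∈ Rg, |P.coeff i / L ^ i * (P.coeff j / L ^ j) *
      ∑ k₁ ∈ Icc 1 ⌊Y⌋₊, ∑ k₂ ∈ Icc 1 ⌊Y⌋₊, a k₁ * a k₂ * ellp Y k₁ ^ i * ellp Y k₂ ^ j *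
        (((2 * β + ellp Y k₁ + ellp Y k₂) ^ 6 - 3 * (2 * β + ellp Y k₁ + ellp Y k₂) ^ 4 * (P2 k₁ + P2 k₂) + 9 * (2 * β + ellp Y k₁ + ellp Y k₂) ^ 2 * (P2 k₁ + P2 k₂) ^ 2 - 6 * (2 * β + ellp Y k₁ + ellp Y k₂) ^ 2 * (P4 k₁ + P4 k₂) - 15 * (P2 k₁ + P2 k₂) ^ 3 + 30 * (P2 k₁ + P2 k₂) * (P4 k₁ + P4 k₂) - 16 * (P6 k₁ + P6 k₂)) / 64 * R₀₀ (α * k₁ * k₂) +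
            (3 * (2 * β + ellp Y k₁ + ellp Y k₂) ^ 5 - 6 * (2 * β + ellp Y k₁ + ellp Y k₂) ^ 3 * (P2 k₁ + P2 k₂) + 9 * (2 * β + ellp Y k₁ + ellp Y k₂) * (P2 k₁ + P2 k₂) ^ 2 - 6 * (2 * β + ellp Y k₁ + ellp Y k₂) * (P4 k₁ + P4 k₂)) / 32 * R₀₁ (α * k₁ * k₂) +
            (3 * (2 * β + ellp Y k₁ + ellp Y k₂) ^ 4 - 9 * (P2 k₁ + P2 k₂) ^ 2 + 6 * (P4 k₁ + P4 k₂)) / 16 * R₀₂ (α * k₁ * k₂) +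
            ((2 * β + ellp Y k₁ + ellp Y k₂) ^ 3 + 3 * (2 * β + ellp Y k₁ + ellp Y k₂) * (P2 k₁ + P2 k₂)) / 8 * R₀₃ (α * k₁ * k₂) +
            (3 * (2 * β + ellp Y k₁ + ellp Y k₂) ^ 5 - 6 * (2 * β + ellp Y k₁ + ellp Y k₂) ^ 3 * (P2 k₁ + P2 k₂) + 9 * (2 * β + ellp Y k₁ + ellp Y k₂) * (P2 k₁ + P2 k₂) ^ 2 - 6 * (2 * β + ellp Y k₁ + ellp Y k₂) * (P4 k₁ + P4 k₂)) / 32 * R₁₀ (α * k₁ * k₂) +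
            (9 * (2 * β + ellp Y k₁ + ellp Y k₂) ^ 4 - 18 * (2 * β + ellp Y k₁ + ellp Y k₂) ^ 2 * (P2 k₁ + P2 k₂) + 27 * (P2 k₁ + P2 k₂) ^ 2 - 18 * (P4 k₁ + P4 k₂)) / 16 * R₁₁ (α * k₁ * k₂) +
            (9 * (2 * β + ellp Y k₁ + ellp Y k₂) ^ 3 - 9 * (2 * β + ellp Y k₁ + ellp Y k₂) * (P2 k₁ + P2 k₂)) / 8 * R₁₂ (α * k₁ * k₂) +
            (3 * (2 * β + ellp Y k₁ + ellp Y k₂) ^ 2 + 3 * (P2 k₁ + P2 k₂)) / 4 * R₁₃ (α * k₁ * k₂) +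
            (3 * (2 * β + ellp Y k₁ + ellp Y k₂) ^ 4 - 9 * (P2 k₁ + P2 k₂) ^ 2 + 6 * (P4 k₁ + P4 k₂)) / 16 * R₂₀ (α * k₁ * k₂) +
            (9 * (2 * β + ellp Y k₁ + ellp Y k₂) ^ 3 - 9 * (2 * β + ellp Y k₁ + ellp Y k₂) * (P2 k₁ + P2 k₂)) / 8 * R₂₁ (α * k₁ * k₂) +
            (9 * (2 * β + ellp Y k₁ + ellp Y k₂) ^ 2 - 9 * (P2 k₁ + P2 k₂)) / 4 * R₂₂ (α * k₁ * k₂) +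
            3 * (2 * β + ellp Y k₁ + ellp Y k₂) / 2 * R₂₃ (α * k₁ * k₂) +
            ((2 * β + ellp Y k₁ + ellp Y k₂) ^ 3 + 3 * (2 * β + ellp Y k₁ + ellp Y k₂) * (P2 k₁ + P2 k₂)) / 8 * R₃₀ (α * k₁ * k₂) +
            (3 * (2 * β + ellp Y k₁ + ellp Y k₂) ^ 2 + 3 * (P2 k₁ + P2 k₂)) / 4 * R₃₁ (α * k₁ * k₂) +
            3 * (2 * β + ellp Y k₁ + ellp Y k₂) / 2 * R₃₂ (α * k₁ * k₂) +
            R₃₃ (α * k₁ * k₂))| ≤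
      |P.coeff i| * |P.coeff j| * G := by
    intro i _ j _
    rcases Nat.eq_zero_or_pos i with rfl | hi
    · rw [hP0]; simp
    rcases Nat.eq_zero_or_pos j with rfl | hj
    · rw [hP0]; simp
    rw [abs_mul, abs_mul, abs_div, abs_div, abs_of_pos (pow_pos hL i), abs_of_pos (pow_pos hL j)]
    have h := abs_monomial_weight_le₃₃ (m₁ := i) (m₂ := j) hi hj hY hΛ hβ hLY hΨ₀ hΨ₂ hΨ₄ hΨ₆ hΨB hΨBD h0 h2 h4 h6 hB hBD
    have hpow : Real.log Y ^ (i + j) / (L ^ i * L ^ j) ≤ 1 := by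
      rw [← pow_add, ← div_pow]
      exact pow_le_one₀ hratio0 hratio
    calc |P.coeff i| / L ^ i * (|P.coeff j| / L ^ j) *
          |∑ k₁ ∈ Icc 1 ⌊Y⌋₊, ∑ k₂ ∈ Icc 1 ⌊Y⌋₊, a k₁ * a k₂ * ellp Y k₁ ^ i * ellp Y k₂ ^ j *
            (((2 * β + ellp Y k₁ + ellp Y k₂) ^ 6 - 3 * (2 * β + ellp Y k₁ + ellp Y k₂) ^ 4 * (P2 k₁ + P2 k₂) + 9 * (2 * β + ellp Y k₁ + ellp Y k₂) ^ 2 * (P2 k₁ + P2 k₂) ^ 2 - 6 * (2 * β + ellp Y k₁ + ellp Y k₂) ^ 2 * (P4 k₁ + P4 k₂) - 15 * (P2 k₁ + P2 k₂) ^ 3 + 30 * (P2 k₁ + P2 k₂) * (P4 k₁ + P4 k₂) - 16 * (P6 k₁ + P6 k₂)) / 64 * R₀₀ (α * k₁ * k₂) +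
            (3 * (2 * β + ellp Y k₁ + ellp Y k₂) ^ 5 - 6 * (2 * β + ellp Y k₁ + ellp Y k₂) ^ 3 * (P2 k₁ + P2 k₂) + 9 * (2 * β + ellp Y k₁ + ellp Y k₂) * (P2 k₁ + P2 k₂) ^ 2 - 6 * (2 * β + ellp Y k₁ + ellp Y k₂) * (P4 k₁ + P4 k₂)) / 32 * R₀₁ (α * k₁ * k₂) +
            (3 * (2 * β + ellp Y k₁ + ellp Y k₂) ^ 4 - 9 * (P2 k₁ + P2 k₂) ^ 2 + 6 * (P4 k₁ + P4 k₂)) / 16 * R₀₂ (α * k₁ * k₂) +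
            ((2 * β + ellp Y k₁ + ellp Y k₂) ^ 3 + 3 * (2 * β + ellp Y k₁ + ellp Y k₂) * (P2 k₁ + P2 k₂)) / 8 * R₀₃ (α * k₁ * k₂) +
            (3 * (2 * β + ellp Y k₁ + ellp Y k₂) ^ 5 - 6 * (2 * β + ellp Y k₁ + ellp Y k₂) ^ 3 * (P2 k₁ + P2 k₂) + 9 * (2 * β + ellp Y k₁ + ellp Y k₂) * (P2 k₁ + P2 k₂) ^ 2 - 6 * (2 * β + ellp Y k₁ + ellp Y k₂) * (P4 k₁ + P4 k₂)) / 32 * R₁₀ (α * k₁ * k₂) +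
            (9 * (2 * β + ellp Y k₁ + ellp Y k₂) ^ 4 - 18 * (2 * β + ellp Y k₁ + ellp Y k₂) ^ 2 * (P2 k₁ + P2 k₂) + 27 * (P2 k₁ + P2 k₂) ^ 2 - 18 * (P4 k₁ + P4 k₂)) / 16 * R₁₁ (α * k₁ * k₂) +
            (9 * (2 * β + ellp Y k₁ + ellp Y k₂) ^ 3 - 9 * (2 * β + ellp Y k₁ + ellp Y k₂) * (P2 k₁ + P2 k₂)) / 8 * R₁₂ (α * k₁ * k₂) +
            (3 * (2 * β + ellp Y k₁ + ellp Y k₂) ^ 2 + 3 * (P2 k₁ + P2 k₂)) / 4 * R₁₃ (α * k₁ * k₂) +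
            (3 * (2 * β + ellp Y k₁ + ellp Y k₂) ^ 4 - 9 * (P2 k₁ + P2 k₂) ^ 2 + 6 * (P4 k₁ + P4 k₂)) / 16 * R₂₀ (α * k₁ * k₂) +
            (9 * (2 * β + ellp Y k₁ + ellp Y k₂) ^ 3 - 9 * (2 * β + ellp Y k₁ + ellp Y k₂) * (P2 k₁ + P2 k₂)) / 8 * R₂₁ (α * k₁ * k₂) +
            (9 * (2 * β + ellp Y k₁ + ellp Y k₂) ^ 2 - 9 * (P2 k₁ + P2 k₂)) / 4 * R₂₂ (α * k₁ * k₂) +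
            3 * (2 * β + ellp Y k₁ + ellp Y k₂) / 2 * R₂₃ (α * k₁ * k₂) +
            ((2 * β + ellp Y k₁ + ellp Y k₂) ^ 3 + 3 * (2 * β + ellp Y k₁ + ellp Y k₂) * (P2 k₁ + P2 k₂)) / 8 * R₃₀ (α * k₁ * k₂) +
            (3 * (2 * β + ellp Y k₁ + ellp Y k₂) ^ 2 + 3 * (P2 k₁ + P2 k₂)) / 4 * R₃₁ (α * k₁ * k₂) +
            3 * (2 * β + ellp Y k₁ + ellp Y k₂) / 2 * R₃₂ (α * k₁ * k₂) +
            R₃₃ (α * k₁ * k₂))|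
        ≤ |P.coeff i| / L ^ i * (|P.coeff j| / L ^ j) * (G * Real.log Y ^ (i + j)) :=
          mul_le_mul_of_nonneg_left h (by positivity)
      _ = |P.coeff i| * |P.coeff j| * G * (Real.log Y ^ (i + j) / (L ^ i * L ^ j)) := by
          field_simp
      _ ≤ |P.coeff i| * |P.coeff j| * G * 1 := by gcongr
      _ = _ := mul_one _
  calc _ ≤ ∑ i ∈ Rg, ∑ j ∈ Rg, |P.coeff i| * |P.coeff j| * G := by
        refine (Finset.abs_sum_le_sum_abs _ _).trans (Finset.sum_le_sum fun i hi ↦ ?_)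
        exact (Finset.abs_sum_le_sum_abs _ _).trans (Finset.sum_le_sum fun j hj ↦ hterm i hi j hj)
    _ = SP * SP * G := by
        rw [hSP, Finset.sum_mul_sum, Finset.sum_mul]
        refine Finset.sum_congr rfl fun i _ ↦ ?_
        rw [Finset.sum_mul]
    _ = SP ^ 2 * G := by ring

end Summit.Parity.GeneralizedHardyLittlewood.Theorems.MomentsBeyondDiagonal.DiagCorner

end
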